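import Literature.AlgebraicGeometry.HodgeTheory.LocallyTrivialExtensionClasses

/-!
# Route LinearSystemTorelli — crux `LocalTubeSpan`: the balls form implies the colimit form

Helper file (`--supports stmt-HodgeConjecture-2490`, line `Sketch`, cycle 4 wave 2, stub
`stub_localKernelOfBalls`).  The crux ("local Schnell theorem", C. Schnell, *Primitive cohomology
and the tube mapping*, Math. Z. 268 (2010) = arXiv:0711.3927, §3, §7) is formalised at a subgroup
`S' ≤ G = π₁(S, s)` — a local fundamental group of the discriminant complement — by the
**surrogate** `ker (evalCoinvOn A S') = H1resKer A S'`: a class undetected by every single element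
of `S'` restricts to zero on `S'`.  The planner types the crux against the tree's
`LocallyTrivialExtensionClasses` in two candidate SHAPES (`Lines/SketchTypedCandidate.lean`):

* the BALLS form — the surrogate at the local subgroups `localSubgroup ι s N' hs' γ` of all
  sufficiently small OPEN neighbourhoods `N'` of a point `t₀ ∈ T`;
* the COLIMIT form — a class undetected by Schnell's third map on the local subgroups of SOME
  neighbourhood `N` of `t₀` lies in the tree's local kernel `localKernel ι V s t₀` (the kernel of
  `H¹(S, 𝕍) → colim_{U ∋ t₀} H¹(U ∩ S, 𝕍)` of P. Brosnan, H. Fang, Z. Nie, G. Pearlstein,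
  *Singularities of admissible normal functions*, Invent. Math. 177 (2009), §1 eq. (1)).

This file is the typed glue BALLS ⇒ COLIMIT:

* `localTubeSpan_evalCoinvOn_eq_zero_of_le` — Schnell's third map on a subgroup is compatible with
  shrinking the subgroup: undetected on `S'` ⇒ undetected on every `S'' ≤ S'`;
* `localTubeSpan_mem_localKernel_of_balls` — the registered stub: shrink `N` and the ball bound `N₀`
  to the open neighbourhood `N' = interior (N ∩ N₀)`, transfer undetectedness to its (smaller,
  `localSubgroup_mono`) local subgroups, apply the surrogate there and conclude by
  `mem_localKernel_iff`.

Pure bookkeeping over the tree's `LocallyTrivialExtensionClasses` (an arbitrary commutative ring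
`k`, continuous `ι : S → T`, local system `V` and base point `s`); no named facts.

References: [Schnell2010] C. Schnell, Primitive cohomology and the tube mapping, Math. Z. 268
(2010), §3 (the third map); [BrosnanFangNiePearlstein2009] P. Brosnan, H. Fang, Z. Nie,
G. Pearlstein, Singularities of admissible normal functions, Invent. Math. 177 (2009), §1 eq. (1).
-/

-- `Summit.HodgeConjecture.HodgeConjecture.Theorems` is the mandated namespace (single-conjunct summit:
-- Sub = Summit), which `linter.dupNamespace` flags on every declaration; the lakefile turns the
-- linter off tree-wide (weak option), restated here so stand-alone elaboration is warning-free too.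
set_option linter.dupNamespace false

noncomputable section

open CategoryTheory groupCohomology
open _root_.Topology Filter
open Literature.AlgebraicGeometry.HodgeTheory

namespace Summit.HodgeConjecture.HodgeConjecture.Theorems

universe u v

/-! ### Schnell's third map on a subgroup is compatible with shrinking the subgroup -/

/-- **Monotonicity of undetectedness.** If Schnell's third map on a subgroup `S` kills a class
`ξ ∈ H¹(G, A)` (`φ g ∈ (g - 1)A` for all `g ∈ S`), then so does the third map on every smaller
subgroup `S' ≤ S` (both have the component `φ g mod (g - 1)A` at `g ∈ S'`). [folklore] -/
theorem localTubeSpan_evalCoinvOn_eq_zero_of_le {k G : Type u} [CommRing k] [Group G] (A : Rep k G)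
    {S S' : Subgroup G} (h : S' ≤ S) {ξ : groupCohomology.H1 A} (hξ : evalCoinvOn A S ξ = 0) :
    evalCoinvOn A S' ξ = 0 := by
  induction ξ using H1_induction_on with
  | h φ =>
    funext g
    have := congr_fun hξ ⟨g.1, h g.2⟩
    rw [evalCoinvOn_H1π, Pi.zero_apply] at this ⊢
    exact this

/-! ### The balls form of the surrogate implies the colimit form -/

/-- **Typed glue: balls form ⇒ colimit form of the local Schnell theorem.** If the surrogate
`ker (evalCoinvOn A S') = H1resKer A S'` holds at the local subgroups
`S' = localSubgroup ι s N' hs' γ` of all sufficiently small open neighbourhoods `N'` of `t₀` (for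
the monodromy representation `A = V_s`), then a class `ξ` killed by Schnell's third map on the
local subgroups of some neighbourhood `N` of `t₀` lies in the local kernel at `t₀` — the kernel of
`H¹(S, 𝕍) → (R¹ j_* 𝕍)_{t₀}` of loc. cit.: shrink to the open `N' = interior (N ∩ N₀)`, whose local
subgroups are smaller (`localSubgroup_mono`), hence still do not detect `ξ`
(`localTubeSpan_evalCoinvOn_eq_zero_of_le`), and apply the surrogate there.
[cite: BrosnanFangNiePearlstein2009, §1 eq. (1)] -/
theorem localTubeSpan_mem_localKernel_of_balls {k S : Type u} [CommRing k] [TopologicalSpace S]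
    {T : Type v} [TopologicalSpace T]
    (ι : C(S, T)) (V : Literature.AlgebraicGeometry.Motives.LocalSystem k S) (s : S) (t₀ : T)
    (hballs : ∃ N₀ ∈ 𝓝 t₀, ∀ N' ∈ 𝓝 t₀, N' ⊆ N₀ → IsOpen N' →
      ∀ (s' : S) (hs' : ι s' ∈ N') (γ : Path s' s),
        LinearMap.ker (evalCoinvOn (monodromyRepObj V s) (localSubgroup ι s N' hs' γ)) =
          H1resKer (monodromyRepObj V s) (localSubgroup ι s N' hs' γ))
    (ξ : groupCohomology.H1 (monodromyRepObj V s))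
    (hξ : ∃ N ∈ 𝓝 t₀, ∀ (s' : S) (hs' : ι s' ∈ N) (γ : Path s' s),
      evalCoinvOn (monodromyRepObj V s) (localSubgroup ι s N hs' γ) ξ = 0) :
    ξ ∈ localKernel ι V s t₀ := by
  obtain ⟨N₀, hN₀, hsur⟩ := hballs
  obtain ⟨N, hN, hzero⟩ := hξ
  have hN'N : interior (N ∩ N₀) ⊆ N := interior_subset.trans Set.inter_subset_left
  have hN'N₀ : interior (N ∩ N₀) ⊆ N₀ := interior_subset.trans Set.inter_subset_right
  refine (mem_localKernel_iff ι V s t₀ ξ).2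
    ⟨interior (N ∩ N₀), interior_mem_nhds.2 (Filter.inter_mem hN hN₀), fun s' hs' γ => ?_⟩
  rw [← hsur (interior (N ∩ N₀)) (interior_mem_nhds.2 (Filter.inter_mem hN hN₀)) hN'N₀
    isOpen_interior s' hs' γ, LinearMap.mem_ker]
  exact localTubeSpan_evalCoinvOn_eq_zero_of_le (monodromyRepObj V s)
    (localSubgroup_mono ι s hN'N hs' γ) (hzero s' (hN'N hs') γ)

end Summit.HodgeConjecture.HodgeConjecture.Theorems

end
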